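import Summits.ResolutionOfSingularities.ResolutionOfSingularities.Theorems.EquisingularLiftEquisingularLiftNatNDFanStarBasics
import HarnessLib

/-!
# [OURS · L1 W4.5(b) · EL♮(3) · ND-K5 (B4α0) support 2/3] THE FAN PROPERTY SURVIVES A STAR: pairwise SEPARATION of the maximal cones by integral
# functionals is preserved by every star subdivision; FRESHNESS of the new ray follows

OURS · L1 W4.5(b) · EL♮(3) stmt-ResolutionOfSingularities-20148 · counted 0 · AI-written (res-L1-w45b-iso-w3 g0, WIDTH TABLE D1′ row iso-w3 (2/2),
desk res-L1-w45b-plan-1 g21 2026-08-28T14:40:28Z), weaker than expert review; nothing of [Hironaka2017] asserted; no statement of the manuscript.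
Sorry-free, standard axioms, DEF-FREE, no instance, no notation. `--supports stmt-ResolutionOfSingularities-20148 --as helper`: support module toward the
registered 4th CHILD stub `stub_elnat_three_isolated_newtonNondegenerate` through the ND-K5 brick **(B4α0) `playFacts : ND.PlayFacts n`** of SPEC v9/v10
`Cruxes/EquisingularLiftNatThree/NewtonNondegenerateRungK5.lean` §13.14 (res-L1-w45b-idea-1 ROUND 12): the COMBINATORIAL DRIVER of the toric model round.
Dim-3 char-p resolution is a theorem in print (Cossart–Piltant 2008/2009); everything here is OUR kernel-own bookkeeping of the local fan game of
`…NatResidueHypDefsND` (p625534: `Ray`, `pair`, `Bad`, `star`, `Reach`, `Won`, `e`, `orthantFan`, `IsConvenientTable`) and `…NatNDChartPlays`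
(`IsSmoothCone`, `zMat`, `rayOf`, `isSmoothCone_starCone`, `not_bad_coordinateFace`, `pair_e`).

THE SEPARATION INVARIANT (spelled out inline, no definition): for two distinct maximal cones `σ₁ ≠ σ₂` there is `u ∈ ℤⁿ` with `u·ρ = 0` on the common rays,
`u·ρ > 0` on the rays of `σ₁` not in `σ₂`, `u·ρ < 0` on the rays of `σ₂` not in `σ₁` («cones meet along common faces», for simplicial cones).
CONTENTS (all PROVED): `pos_of_dominate` / `neg_of_dominate` (integer arithmetic); ★ `sum_not_mem_of_separated` (FRESHNESS: under separation the new ray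
`Σ τ` of a star at `τ ⊆ σ ∈ Φ` is a ray of NO cone `σ' ⊉ τ` of `Φ`); ★ `exists_separator_old_new` (old cone `σ₁ ⊉ τ` | new cone `insert (Σ τ) (σ₂ ∖ t)`:
separator `N·u + (t* − s*)`, `s ∈ τ ∖ σ₁`, duals of the smooth `σ₂`, `N = 1 + Σ_{σ₁} |(t* − s*)·ρ|`); ★ `exists_separator_new_new` (two new cones from
`σ₁ ⊇ τ`, `σ₂ ⊇ τ`, `σ₁ = σ₂` allowed with `u = 0`: separator `N·u + (t'* − t*)`, duals of the smooth `σ₁`); ★ `separated_star` (the invariant survives a star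
at any face of a cone of a fan with smooth cones); `isSmoothCone_star` (smoothness survives, from the tree's `isSmoothCone_starCone`);
`not_frame_subset_star` («no maximal cone contains the whole frame» survives a legal star).  Used by `…NatNDPlayFacts` (3/3).
-/

noncomputable section

set_option linter.dupNamespace false

open Matrix

namespace Summit.ResolutionOfSingularities.ResolutionOfSingularities.Cruxes.EquisingularLiftNat.Sections.ND

open Summit.ResolutionOfSingularities.ResolutionOfSingularities.Cruxes.EquisingularLiftNat.Sections

variable {n : ℕ}

/-! ### E. SEPARATION: freshness of the new ray, and the two separator updates under a star -/

/-- Integer domination: `N·a + b > 0` when `a ≥ 1` and `N ≥ 1 + |b|`. [OURS · arithmetic] -/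
theorem pos_of_dominate {N a b : ℤ} (ha : 1 ≤ a) (hN : 1 + |b| ≤ N) : 0 < N * a + b := by
  have hb := abs_nonneg b
  have h1 : N ≤ N * a := by nlinarith
  have h2 := neg_abs_le b
  linarith

/-- Integer domination: `N·a + b < 0` when `a ≤ -1` and `N ≥ 1 + |b|`. [OURS · arithmetic] -/
theorem neg_of_dominate {N a b : ℤ} (ha : a ≤ -1) (hN : 1 + |b| ≤ N) : N * a + b < 0 := by
  have hb := abs_nonneg b
  have h1 : N * a ≤ -N := by nlinarith
  have h2 := le_abs_self b
  linarith

/-- **FRESHNESS from separation.** If the maximal cones of `Φ` are pairwise separated by integral functionals (non-negative on one, non-positive on the other,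
zero exactly on the common rays), then the new ray `Σ τ` of a star at `τ ⊆ σ ∈ Φ` is NOT a ray of any cone `σ' ∈ Φ` with `τ ⊄ σ'`. [OURS · L1 W4.5b] -/
theorem sum_not_mem_of_separated {Φ : Finset (Finset (Ray n))} {τ σ σ' : Finset (Ray n)}
    (hSep : ∀ σ₁ ∈ Φ, ∀ σ₂ ∈ Φ, σ₁ ≠ σ₂ → ∃ u : Ray n, (∀ ρ ∈ σ₁, ρ ∈ σ₂ → u ⬝ᵥ ρ = 0) ∧
      (∀ ρ ∈ σ₁, ρ ∉ σ₂ → 0 < u ⬝ᵥ ρ) ∧ (∀ ρ ∈ σ₂, ρ ∉ σ₁ → u ⬝ᵥ ρ < 0))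
    (hσ : σ ∈ Φ) (hτσ : τ ⊆ σ) (hσ' : σ' ∈ Φ) (hτσ' : ¬ τ ⊆ σ') : (∑ ρ ∈ τ, ρ) ∉ σ' := by
  classical
  have hne : σ ≠ σ' := by rintro rfl; exact hτσ' hτσ
  obtain ⟨u, h0, hpos, hneg⟩ := hSep σ hσ σ' hσ' hne
  obtain ⟨s, hsτ, hsσ'⟩ := Finset.not_subset.1 hτσ'
  have hv : 0 < u ⬝ᵥ (∑ ρ ∈ τ, ρ) := by
    rw [dotProduct_finset_sum, ← Finset.add_sum_erase τ _ hsτ]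
    have h1 : 0 < u ⬝ᵥ s := hpos s (hτσ hsτ) hsσ'
    have h2 : 0 ≤ ∑ ρ ∈ τ.erase s, u ⬝ᵥ ρ := Finset.sum_nonneg fun ρ hρ => by
      have hρσ : ρ ∈ σ := hτσ (Finset.mem_of_mem_erase hρ)
      by_cases hρσ' : ρ ∈ σ'
      · exact (h0 ρ hρσ hρσ').symm.le
      · exact (hpos ρ hρσ hρσ').le
    linarith
  intro hvσ'
  by_cases hvσ : (∑ ρ ∈ τ, ρ) ∈ σ
  · exact absurd (h0 _ hvσ hvσ') hv.ne'
  · exact absurd (hneg _ hvσ' hvσ) (not_lt.2 hv.le)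

/-- **SEPARATOR UPDATE (old cone | new cone).** An old cone `σ₁ ⊉ τ` and a new cone `insert (Σ τ) (σ₂.erase t)` (`τ ⊆ σ₂` smooth, `t ∈ τ`) are separated
by `N·u + (t* − s*)`, where `u` separates `σ₁ | σ₂`, `s ∈ τ ∖ σ₁`, `t*, s*` are dual vectors of `σ₂`, and `N` dominates. [OURS · L1 W4.5b · the fan
property under star subdivision, case 1] -/
theorem exists_separator_old_new {σ₁ σ₂ τ : Finset (Ray n)} (hσ₂ : IsSmoothCone σ₂) (hτ : τ ⊆ σ₂) {t s : Ray n} (ht : t ∈ τ)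
    (hs : s ∈ τ) (hs₁ : s ∉ σ₁) (hv : (∑ ρ ∈ τ, ρ) ∉ σ₁) {u : Ray n}
    (h0 : ∀ ρ ∈ σ₁, ρ ∈ σ₂ → u ⬝ᵥ ρ = 0) (hpos : ∀ ρ ∈ σ₁, ρ ∉ σ₂ → 0 < u ⬝ᵥ ρ)
    (hneg : ∀ ρ ∈ σ₂, ρ ∉ σ₁ → u ⬝ᵥ ρ < 0) :
    ∃ u' : Ray n,
      (∀ ρ ∈ σ₁, ρ ∈ insert (∑ ρ ∈ τ, ρ) (σ₂.erase t) → u' ⬝ᵥ ρ = 0) ∧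
      (∀ ρ ∈ σ₁, ρ ∉ insert (∑ ρ ∈ τ, ρ) (σ₂.erase t) → 0 < u' ⬝ᵥ ρ) ∧
      (∀ ρ ∈ insert (∑ ρ ∈ τ, ρ) (σ₂.erase t), ρ ∉ σ₁ → u' ⬝ᵥ ρ < 0) := by
  classical
  obtain ⟨wt, hwt1, hwt0⟩ := exists_dual_of_isSmoothCone hσ₂ (hτ ht)
  obtain ⟨ws, hws1, hws0⟩ := exists_dual_of_isSmoothCone hσ₂ (hτ hs)
  set ψ : Ray n := wt - ws with hψ
  set N : ℤ := 1 + ∑ ρ ∈ σ₁, |ψ ⬝ᵥ ρ| with hN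
  have hN1 : 1 ≤ N := by
    have := Finset.sum_nonneg (fun ρ (_ : ρ ∈ σ₁) => abs_nonneg (ψ ⬝ᵥ ρ)); linarith
  have hNdom : ∀ ρ ∈ σ₁, 1 + |ψ ⬝ᵥ ρ| ≤ N := fun ρ hρ => by
    have := Finset.single_le_sum (fun ρ' (_ : ρ' ∈ σ₁) => abs_nonneg (ψ ⬝ᵥ ρ')) hρ
    linarith
  have hform : ∀ ρ : Ray n, (N • u + ψ) ⬝ᵥ ρ = N * (u ⬝ᵥ ρ) + (wt ⬝ᵥ ρ - ws ⬝ᵥ ρ) := fun ρ => by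
    rw [add_dotProduct, smul_dotProduct, smul_eq_mul, hψ, sub_dotProduct]
  have hψρ : ∀ ρ : Ray n, ψ ⬝ᵥ ρ = wt ⬝ᵥ ρ - ws ⬝ᵥ ρ := fun ρ => by rw [hψ, sub_dotProduct]
  -- the new ray
  have huv : u ⬝ᵥ (∑ ρ ∈ τ, ρ) ≤ -1 := by
    rw [dotProduct_finset_sum, ← Finset.add_sum_erase τ _ hs]
    have h1 : u ⬝ᵥ s < 0 := hneg s (hτ hs) hs₁
    have h2 : ∑ ρ ∈ τ.erase s, u ⬝ᵥ ρ ≤ 0 := Finset.sum_nonpos fun ρ hρ => by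
      have hρσ : ρ ∈ σ₂ := hτ (Finset.mem_of_mem_erase hρ)
      by_cases hρ₁ : ρ ∈ σ₁
      · exact (h0 ρ hρ₁ hρσ).le
      · exact (hneg ρ hρσ hρ₁).le
    linarith
  have hψv : wt ⬝ᵥ (∑ ρ ∈ τ, ρ) - ws ⬝ᵥ (∑ ρ ∈ τ, ρ) = 0 := by
    rw [dotProduct_finset_sum, dotProduct_finset_sum, sum_dual_eq_one hτ ht hwt1 hwt0, sum_dual_eq_one hτ hs hws1 hws0]; ring
  refine ⟨N • u + ψ, fun ρ hρ₁ hρ => ?_, fun ρ hρ₁ hρ => ?_, fun ρ hρ hρ₁ => ?_⟩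
  · -- common rays: ρ ∈ σ₁, ρ ∈ σ₂ ∖ {t}
    rw [hform]
    rcases Finset.mem_insert.1 hρ with rfl | hρ'
    · exact absurd hρ₁ hv
    · have hρt : ρ ≠ t := Finset.ne_of_mem_erase hρ'
      have hρσ₂ : ρ ∈ σ₂ := Finset.mem_of_mem_erase hρ'
      have hρs : ρ ≠ s := by rintro rfl; exact hs₁ hρ₁
      rw [h0 ρ hρ₁ hρσ₂, hwt0 ρ hρσ₂ hρt, hws0 ρ hρσ₂ hρs]; ring
  · -- rays of σ₁ off the new cone
    rw [hform]
    have hρv : ρ ≠ ∑ ρ ∈ τ, ρ := by rintro rfl; exact hv hρ₁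
    by_cases hρσ₂ : ρ ∈ σ₂
    · -- then ρ = t
      have hρt : ρ = t := by
        by_contra hne
        exact hρ (Finset.mem_insert_of_mem (Finset.mem_erase.2 ⟨hne, hρσ₂⟩))
      subst hρt
      have hρs : ρ ≠ s := by rintro rfl; exact hs₁ hρ₁
      rw [h0 ρ hρ₁ hρσ₂, hwt1, hws0 ρ hρσ₂ hρs]; norm_num
    · have h1 : 1 ≤ u ⬝ᵥ ρ := hpos ρ hρ₁ hρσ₂
      have := pos_of_dominate h1 (hNdom ρ hρ₁)
      rw [hψρ] at this
      exact this
  · -- rays of the new cone off σ₁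
    rw [hform]
    rcases Finset.mem_insert.1 hρ with rfl | hρ'
    · rw [hψv, add_zero]
      nlinarith
    · have hρt : ρ ≠ t := Finset.ne_of_mem_erase hρ'
      have hρσ₂ : ρ ∈ σ₂ := Finset.mem_of_mem_erase hρ'
      have h1 : u ⬝ᵥ ρ ≤ -1 := by have := hneg ρ hρσ₂ hρ₁; omega
      have h2 : wt ⬝ᵥ ρ - ws ⬝ᵥ ρ ≤ 0 := by
        rw [hwt0 ρ hρσ₂ hρt]
        by_cases hρs : ρ = s
        · subst hρs; rw [hws1]; norm_num
        · rw [hws0 ρ hρσ₂ hρs]; norm_num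
      nlinarith

/-- **SEPARATOR UPDATE (new cone | new cone).** Two new cones `insert (Σ τ) (σ₁.erase t)`, `insert (Σ τ) (σ₂.erase t')` (`τ ⊆ σ₁ ∩ σ₂`, `σ₁` smooth,
`t, t' ∈ τ`; `σ₁ = σ₂` allowed with `u = 0`) are separated by `N·u + (t'* − t*)` with `t*, t'*` dual vectors of `σ₁`. [OURS · L1 W4.5b · the fan property
under star subdivision, case 2] -/
theorem exists_separator_new_new {σ₁ σ₂ τ : Finset (Ray n)} (hσ₁ : IsSmoothCone σ₁) (hτ₁ : τ ⊆ σ₁) (hτ₂ : τ ⊆ σ₂) {t t' : Ray n}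
    (ht : t ∈ τ) (ht' : t' ∈ τ) {u : Ray n}
    (h0 : ∀ ρ ∈ σ₁, ρ ∈ σ₂ → u ⬝ᵥ ρ = 0) (hpos : ∀ ρ ∈ σ₁, ρ ∉ σ₂ → 0 < u ⬝ᵥ ρ)
    (hneg : ∀ ρ ∈ σ₂, ρ ∉ σ₁ → u ⬝ᵥ ρ < 0) :
    ∃ u' : Ray n,
      (∀ ρ ∈ insert (∑ ρ ∈ τ, ρ) (σ₁.erase t), ρ ∈ insert (∑ ρ ∈ τ, ρ) (σ₂.erase t') → u' ⬝ᵥ ρ = 0) ∧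
      (∀ ρ ∈ insert (∑ ρ ∈ τ, ρ) (σ₁.erase t), ρ ∉ insert (∑ ρ ∈ τ, ρ) (σ₂.erase t') → 0 < u' ⬝ᵥ ρ) ∧
      (∀ ρ ∈ insert (∑ ρ ∈ τ, ρ) (σ₂.erase t'), ρ ∉ insert (∑ ρ ∈ τ, ρ) (σ₁.erase t) → u' ⬝ᵥ ρ < 0) := by
  classical
  obtain ⟨wt, hwt1, hwt0⟩ := exists_dual_of_isSmoothCone hσ₁ (hτ₁ ht)
  obtain ⟨wt', hwt'1, hwt'0⟩ := exists_dual_of_isSmoothCone hσ₁ (hτ₁ ht')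
  set ψ : Ray n := wt' - wt with hψ
  set N : ℤ := 1 + ∑ ρ ∈ σ₁ ∪ σ₂, |ψ ⬝ᵥ ρ| with hN
  have hN1 : 1 ≤ N := by
    have := Finset.sum_nonneg (fun ρ (_ : ρ ∈ σ₁ ∪ σ₂) => abs_nonneg (ψ ⬝ᵥ ρ)); linarith
  have hNdom : ∀ ρ ∈ σ₁ ∪ σ₂, 1 + |ψ ⬝ᵥ ρ| ≤ N := fun ρ hρ => by
    have := Finset.single_le_sum (fun ρ' (_ : ρ' ∈ σ₁ ∪ σ₂) => abs_nonneg (ψ ⬝ᵥ ρ')) hρ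
    linarith
  have hform : ∀ ρ : Ray n, (N • u + ψ) ⬝ᵥ ρ = N * (u ⬝ᵥ ρ) + (wt' ⬝ᵥ ρ - wt ⬝ᵥ ρ) := fun ρ => by
    rw [add_dotProduct, smul_dotProduct, smul_eq_mul, hψ, sub_dotProduct]
  have hψρ : ∀ ρ : Ray n, ψ ⬝ᵥ ρ = wt' ⬝ᵥ ρ - wt ⬝ᵥ ρ := fun ρ => by rw [hψ, sub_dotProduct]
  have huv : u ⬝ᵥ (∑ ρ ∈ τ, ρ) = 0 := by
    rw [dotProduct_finset_sum]
    exact Finset.sum_eq_zero fun ρ hρ => h0 ρ (hτ₁ hρ) (hτ₂ hρ)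
  have hψv : wt' ⬝ᵥ (∑ ρ ∈ τ, ρ) - wt ⬝ᵥ (∑ ρ ∈ τ, ρ) = 0 := by
    rw [dotProduct_finset_sum, dotProduct_finset_sum, sum_dual_eq_one hτ₁ ht' hwt'1 hwt'0, sum_dual_eq_one hτ₁ ht hwt1 hwt0]; ring
  refine ⟨N • u + ψ, fun ρ hρa hρb => ?_, fun ρ hρa hρb => ?_, fun ρ hρb hρa => ?_⟩
  · rw [hform]
    rcases Finset.mem_insert.1 hρa with rfl | hρa'
    · rw [huv, hψv]; ring
    · have hρt : ρ ≠ t := Finset.ne_of_mem_erase hρa'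
      have hρσ₁ : ρ ∈ σ₁ := Finset.mem_of_mem_erase hρa'
      rcases Finset.mem_insert.1 hρb with hρv | hρb'
      · rw [hρv, huv, hψv]; ring
      · have hρt' : ρ ≠ t' := Finset.ne_of_mem_erase hρb'
        have hρσ₂ : ρ ∈ σ₂ := Finset.mem_of_mem_erase hρb'
        rw [h0 ρ hρσ₁ hρσ₂, hwt'0 ρ hρσ₁ hρt', hwt0 ρ hρσ₁ hρt]; ring
  · rw [hform]
    have hρv : ρ ≠ ∑ ρ ∈ τ, ρ := by rintro rfl; exact hρb (Finset.mem_insert_self _ _)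
    have hρa' : ρ ∈ σ₁.erase t := (Finset.mem_insert.1 hρa).resolve_left hρv
    have hρt : ρ ≠ t := Finset.ne_of_mem_erase hρa'
    have hρσ₁ : ρ ∈ σ₁ := Finset.mem_of_mem_erase hρa'
    by_cases hρσ₂ : ρ ∈ σ₂
    · have hρt' : ρ = t' := by
        by_contra hne
        exact hρb (Finset.mem_insert_of_mem (Finset.mem_erase.2 ⟨hne, hρσ₂⟩))
      subst hρt'
      rw [h0 ρ hρσ₁ hρσ₂, hwt'1, hwt0 ρ hρσ₁ hρt]; norm_num
    · have h1 : 1 ≤ u ⬝ᵥ ρ := hpos ρ hρσ₁ hρσ₂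
      have := pos_of_dominate h1 (hNdom ρ (Finset.mem_union_left _ hρσ₁))
      rw [hψρ] at this
      exact this
  · rw [hform]
    have hρv : ρ ≠ ∑ ρ ∈ τ, ρ := by rintro rfl; exact hρa (Finset.mem_insert_self _ _)
    have hρb' : ρ ∈ σ₂.erase t' := (Finset.mem_insert.1 hρb).resolve_left hρv
    have hρt' : ρ ≠ t' := Finset.ne_of_mem_erase hρb'
    have hρσ₂ : ρ ∈ σ₂ := Finset.mem_of_mem_erase hρb'
    by_cases hρσ₁ : ρ ∈ σ₁
    · have hρt : ρ = t := by
        by_contra hne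
        exact hρa (Finset.mem_insert_of_mem (Finset.mem_erase.2 ⟨hne, hρσ₁⟩))
      subst hρt
      rw [h0 ρ hρσ₁ hρσ₂, hwt1, hwt'0 ρ hρσ₁ hρt']; norm_num
    · have h1 : u ⬝ᵥ ρ ≤ -1 := by have := hneg ρ hρσ₂ hρσ₁; omega
      have := neg_of_dominate h1 (hNdom ρ (Finset.mem_union_right _ hρσ₂))
      rw [hψρ] at this
      exact this

/-- **THE FAN PROPERTY SURVIVES A STAR**: if the maximal cones of `Φ` are smooth and pairwise separated, so are (separated) the maximal cones of `star Φ τ`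
for any face `τ` of a cone of `Φ`. [OURS · L1 W4.5b · (B4α0) core] -/
theorem separated_star {Φ : Finset (Finset (Ray n))} {τ σ₀ : Finset (Ray n)}
    (hS : ∀ σ ∈ Φ, IsSmoothCone σ)
    (hSep : ∀ σ₁ ∈ Φ, ∀ σ₂ ∈ Φ, σ₁ ≠ σ₂ → ∃ u : Ray n, (∀ ρ ∈ σ₁, ρ ∈ σ₂ → u ⬝ᵥ ρ = 0) ∧
      (∀ ρ ∈ σ₁, ρ ∉ σ₂ → 0 < u ⬝ᵥ ρ) ∧ (∀ ρ ∈ σ₂, ρ ∉ σ₁ → u ⬝ᵥ ρ < 0))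
    (hσ₀ : σ₀ ∈ Φ) (hτσ₀ : τ ⊆ σ₀) :
    ∀ γ₁ ∈ star Φ τ, ∀ γ₂ ∈ star Φ τ, γ₁ ≠ γ₂ → ∃ u : Ray n, (∀ ρ ∈ γ₁, ρ ∈ γ₂ → u ⬝ᵥ ρ = 0) ∧
      (∀ ρ ∈ γ₁, ρ ∉ γ₂ → 0 < u ⬝ᵥ ρ) ∧ (∀ ρ ∈ γ₂, ρ ∉ γ₁ → u ⬝ᵥ ρ < 0) := by
  classical
  -- the (old | new) case, packaged once
  have oldnew : ∀ γ₁ ∈ Φ, ¬ τ ⊆ γ₁ → ∀ σ₂ ∈ Φ, τ ⊆ σ₂ → ∀ t ∈ τ,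
      ∃ u : Ray n, (∀ ρ ∈ γ₁, ρ ∈ insert (∑ ρ ∈ τ, ρ) (σ₂.erase t) → u ⬝ᵥ ρ = 0) ∧
        (∀ ρ ∈ γ₁, ρ ∉ insert (∑ ρ ∈ τ, ρ) (σ₂.erase t) → 0 < u ⬝ᵥ ρ) ∧
        (∀ ρ ∈ insert (∑ ρ ∈ τ, ρ) (σ₂.erase t), ρ ∉ γ₁ → u ⬝ᵥ ρ < 0) := by
    intro γ₁ hγ₁ hτγ₁ σ₂ hσ₂ hτσ₂ t ht
    have hne : γ₁ ≠ σ₂ := by rintro rfl; exact hτγ₁ hτσ₂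
    obtain ⟨u, h0, hpos, hneg⟩ := hSep γ₁ hγ₁ σ₂ hσ₂ hne
    obtain ⟨s, hsτ, hsγ₁⟩ := Finset.not_subset.1 hτγ₁
    have hv : (∑ ρ ∈ τ, ρ) ∉ γ₁ := sum_not_mem_of_separated hSep hσ₀ hτσ₀ hγ₁ hτγ₁
    exact exists_separator_old_new (hS σ₂ hσ₂) hτσ₂ ht hsτ hsγ₁ hv h0 hpos hneg
  intro γ₁ hγ₁ γ₂ hγ₂ hne
  rcases (mem_star_iff Φ τ γ₁).1 hγ₁ with ⟨hγ₁Φ, hτγ₁⟩ | ⟨σ₁, hσ₁, hτσ₁, t, ht, rfl⟩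
  · rcases (mem_star_iff Φ τ γ₂).1 hγ₂ with ⟨hγ₂Φ, -⟩ | ⟨σ₂, hσ₂, hτσ₂, t', ht', rfl⟩
    · exact hSep γ₁ hγ₁Φ γ₂ hγ₂Φ hne
    · exact oldnew γ₁ hγ₁Φ hτγ₁ σ₂ hσ₂ hτσ₂ t' ht'
  · rcases (mem_star_iff Φ τ γ₂).1 hγ₂ with ⟨hγ₂Φ, hτγ₂⟩ | ⟨σ₂, hσ₂, hτσ₂, t', ht', rfl⟩
    · obtain ⟨u, h0, hpos, hneg⟩ := oldnew γ₂ hγ₂Φ hτγ₂ σ₁ hσ₁ hτσ₁ t ht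
      refine ⟨-u, fun ρ hρa hρb => ?_, fun ρ hρa hρb => ?_, fun ρ hρb hρa => ?_⟩
      · rw [neg_dotProduct, h0 ρ hρb hρa, neg_zero]
      · rw [neg_dotProduct]; have := hneg ρ hρa hρb; linarith
      · rw [neg_dotProduct]; have := hpos ρ hρb hρa; linarith
    · by_cases hσ : σ₁ = σ₂
      · subst hσ
        exact exists_separator_new_new (u := 0) (hS σ₁ hσ₁) hτσ₁ hτσ₁ ht ht' (fun ρ _ _ => by simp)
          (fun ρ h1 h2 => absurd h1 h2) (fun ρ h1 h2 => absurd h1 h2)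
      · obtain ⟨u, h0, hpos, hneg⟩ := hSep σ₁ hσ₁ σ₂ hσ₂ hσ
        exact exists_separator_new_new (hS σ₁ hσ₁) hτσ₁ hτσ₂ ht ht' h0 hpos hneg

/-- Smoothness survives a star (from the tree's `isSmoothCone_starCone`). [OURS · L1 W4.5b] -/
theorem isSmoothCone_star {Φ : Finset (Finset (Ray n))} {τ : Finset (Ray n)} (hS : ∀ σ ∈ Φ, IsSmoothCone σ) :
    ∀ γ ∈ star Φ τ, IsSmoothCone γ := by
  intro γ hγ
  rcases (mem_star_iff Φ τ γ).1 hγ with ⟨hγΦ, -⟩ | ⟨σ, hσ, hτσ, t, ht, rfl⟩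
  · exact hS γ hγΦ
  · exact isSmoothCone_starCone (hS σ hσ) hτσ ht

/-- «No maximal cone contains the whole frame» survives a legal star (the new ray is never a frame ray). [OURS · L1 W4.5b] -/
theorem not_frame_subset_star {V : Finset (Fin n → ℕ)} (hV : V.Nonempty) {Φ : Finset (Finset (Ray n))} {τ : Finset (Ray n)}
    (hS : ∀ σ ∈ Φ, IsSmoothCone σ) (hB : Bad V τ)
    (hold : ∀ σ ∈ Φ, ¬ τ ⊆ σ → ¬ Finset.univ.image (e n) ⊆ σ)
    (hnew : ∀ σ ∈ Φ, τ ⊆ σ → ∀ t ∈ τ, ¬ Finset.univ.image (e n) ⊆ σ.erase t) :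
    ∀ γ ∈ star Φ τ, ¬ Finset.univ.image (e n) ⊆ γ := by
  classical
  intro γ hγ hsub
  rcases (mem_star_iff Φ τ γ).1 hγ with ⟨hγΦ, hτγ⟩ | ⟨σ, hσ, hτσ, t, ht, rfl⟩
  · exact hold γ hγΦ hτγ hsub
  · apply hnew σ hσ hτσ t ht
    intro x hx
    obtain ⟨j, -, rfl⟩ := Finset.mem_image.1 hx
    rcases Finset.mem_insert.1 (hsub hx) with h | h
    · exact absurd h.symm (sum_ne_e_of_isSmoothCone (hS σ hσ) hτσ (exists_ne_of_bad hV hB) j)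
    · exact h


end Summit.ResolutionOfSingularities.ResolutionOfSingularities.Cruxes.EquisingularLiftNat.Sections.ND

end
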